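import Literature.NumberTheory.EllipticCurves.TwoIsogenySelmerGroupRankProofs
import Literature.NumberTheory.EllipticCurves.BinaryQuarticGoodReductionSolubilityProofs
import Literature.NumberTheory.DiophantineGeometry.LindMordellQuarticsHassePrincipleFailure
import Literature.NumberTheory.QuadraticForms.PadicSquares
import Mathlib.Tactic.Simproc.Factors
import HarnessLib

/-!
# The `2`-isogeny Selmer group `S(16, 60)` of `X' : y² = x³ + 16x² + 60x = x(x+6)(x+10)` is ALL sixteen
# classes `±d`, `d ∣ 30`: `dim₂ S^{(φ)}(X/ℚ) = 4` for `X : y² = x³ − 8x² + x` (Silverman, AEC X.4.9)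

Topic `NumberTheory/EllipticCurves`. Second of three files (`XCubeSub8XSqAddXRankZero`, this, `XCubeSub8XSqAddXSha`).
In the tree's vocabulary `S'(−8, 1) = S(16, 60)` is the set of squarefree `d ∣ 60` whose homogeneous space
`C_d : w² = d u⁴ + 16 u²z² + (60/d) z⁴` (a `φ`-covering of `X' = X.twoIsogenyCodomain`, a torsor under `X`) has
points over `ℝ` and every `ℚ_p`. Nine classes are exhibited:

* `1, 15, −6, −10` from the rational points `O`, `(0,0)`, `(−6,0)`, `(−10,0)` of `X'` (integral points of the
  quartics);
* `−1, 2, 3, 5, 6` by EXPLICIT LOCAL POINTS: a real point, a `ℚ₂`-point (a value `4^m·c`, `c ≡ 1 (mod 8)`, tree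
  `padicInt_isSquare_of_toZModPow_three_eq_one`), `ℚ₃`- and `ℚ₅`-points (values `q^{2m}·c`, `c` a non-zero square
  mod `q`, tree `exists_sq_eq_intCast`), and good reduction at every `p ≥ 7` (`Δ(C_d) = 2¹⁴·3·5`, tree
  `BinaryQuartic.isSoluble_padic_of_not_dvd_disc`, Bhargava–Shankar Prop. 5.13);

since `#S(16,60) = 2^{dim}` (tree `two_pow_twoIsogenySelmerRank_eq_card`) and `dim ≤ ω(60) + 1 = 4`, nine members
force **`dim₂ S(16, 60) = 4`**: all sixteen classes are everywhere locally soluble. Only four of them come from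
`X'(ℚ)` (third file), which is where `Ш(X/ℚ)[φ] ≅ (ℤ/2ℤ)²` comes from.

Everything is re-verified by the kernel (the local points were found by a plain search). Theorems only.

## References

* [SilvermanAEC2009] J. H. Silverman, *AEC*, 2nd ed.: Prop. X.4.9, proof of Prop. X.6.2(b) and Prop. X.6.5(a)
  (local points of homogeneous spaces by lifting square roots).
* [BhargavaShankarAnnals2015] M. Bhargava, A. Shankar, Ann. of Math. 181 (2015), Prop. 5.13.
* [SilvermanTate2015] J. H. Silverman, J. Tate, *Rational Points on Elliptic Curves*, §3.5–§3.6.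
-/

noncomputable section

open scoped Classical

namespace Literature.NumberTheory.EllipticCurves

namespace XCubeSub8XSqAddX

open Literature.NumberTheory.DiophantineGeometry.LindMordellQuartics (exists_sq_eq_intCast)
open Literature.NumberTheory.QuadraticForms (padicInt_isSquare_of_toZModPow_three_eq_one)

/-! ## 3. `S'(−8, 1) = S(16, 60)` is everything: nine explicit everywhere-locally-soluble classes -/

/-- `Δ(⟨d, 0, 16, 0, e⟩) = 16·de·(256 − 4de)² = 245760 = 2¹⁴·3·5` for `de = 60`.
[cite: BhargavaShankarAnnals2015, §1.2 (discriminant formula)] -/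
private theorem disc_C (d e : ℤ) (hde : d * e = 60) : (twoIsogenyQuartic 16 d e).disc = 245760 := by
  simp only [twoIsogenyQuartic, BinaryQuartic.disc]
  linear_combination (256 * ((d * e) ^ 2 + 60 * (d * e) + 3600) - 32768 * (d * e + 60) + 1048576) * hde

/-- A prime `p ≥ 7` does not divide `245760 = 2¹⁴·3·5`. [folklore] -/
private theorem not_dvd_disc {p : ℕ} [hp : Fact p.Prime] (h7 : 7 ≤ p) : ¬ (p : ℤ) ∣ 245760 := by
  intro h
  have hP : p.Prime := hp.out
  have h' : p ∣ 2 ^ 14 * 3 * 5 := by exact_mod_cast h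
  rcases (Nat.Prime.dvd_mul hP).mp h' with h23 | h5
  · rcases (Nat.Prime.dvd_mul hP).mp h23 with h2 | h3
    · have := (Nat.prime_dvd_prime_iff_eq hP Nat.prime_two).mp (hP.dvd_of_dvd_pow h2); omega
    · have := (Nat.prime_dvd_prime_iff_eq hP Nat.prime_three).mp h3; omega
  · have := (Nat.prime_dvd_prime_iff_eq hP (by norm_num : Nat.Prime 5)).mp h5; omega

/-- A real point from a positive value: `f(u, z) = v > 0` gives `(u, z, √v)`. [folklore] -/
private theorem isSoluble_real_of_pos {d e u z v : ℤ} (huz : u ≠ 0 ∨ z ≠ 0) (hv : 0 < v)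
    (hval : d * u ^ 4 + 16 * u ^ 2 * z ^ 2 + e * z ^ 4 = v) :
    ((twoIsogenyQuartic 16 d e).map (Int.castRingHom ℝ)).IsSoluble := by
  refine ⟨u, z, Real.sqrt v, ?_, ?_⟩
  · rcases huz with h | h
    · exact Or.inl (by exact_mod_cast h)
    · exact Or.inr (by exact_mod_cast h)
  · rw [eval_map_twoIsogenyQuartic, Real.sq_sqrt (by exact_mod_cast hv.le)]
    simp only [eq_intCast]
    exact_mod_cast hval.symm

/-- A `ℚ_q`-point from a square root in `ℤ_q`: `f(u, z) = c·k²` with `r² = c` gives `(u, z, k r)`.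
[cite: SilvermanAEC2009, proof of Prop. X.6.2(b) (local points by lifting square roots)] -/
private theorem isSoluble_padic_of_sq {q : ℕ} [Fact q.Prime] {d e u z k c : ℤ} (huz : u ≠ 0 ∨ z ≠ 0)
    (hval : d * u ^ 4 + 16 * u ^ 2 * z ^ 2 + e * z ^ 4 = c * k ^ 2) {r : ℤ_[q]} (hr : r ^ 2 = c) :
    ((twoIsogenyQuartic 16 d e).map (Int.castRingHom ℚ_[q])).IsSoluble := by
  refine ⟨u, z, (k : ℚ_[q]) * r, ?_, ?_⟩
  · rcases huz with h | h
    · exact Or.inl (by exact_mod_cast h)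
    · exact Or.inr (by exact_mod_cast h)
  · have h := congrArg ((↑) : ℤ_[q] → ℚ_[q]) hr
    push_cast at h
    have hv : ((d * u ^ 4 + 16 * u ^ 2 * z ^ 2 + e * z ^ 4 : ℤ) : ℚ_[q]) = ((c * k ^ 2 : ℤ) : ℚ_[q]) := by
      rw [hval]
    push_cast at hv
    rw [eval_map_twoIsogenyQuartic, mul_pow, h]
    simp only [eq_intCast]
    linear_combination -hv

/-- An integral point `f(u, z) = w²` gives a point over every field of characteristic `0`. [folklore] -/
private theorem isSoluble_of_int_point {R : Type*} [Field R] [CharZero R] {d e u z w : ℤ}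
    (huz : u ≠ 0 ∨ z ≠ 0) (h : d * u ^ 4 + 16 * u ^ 2 * z ^ 2 + e * z ^ 4 = w ^ 2) :
    ((twoIsogenyQuartic 16 d e).map (Int.castRingHom R)).IsSoluble := by
  refine ⟨u, z, w, ?_, ?_⟩
  · rcases huz with h | h
    · exact Or.inl (by exact_mod_cast h)
    · exact Or.inr (by exact_mod_cast h)
  · rw [eval_map_twoIsogenyQuartic]
    simp only [eq_intCast]
    exact_mod_cast h.symm

/-- A `2`-adic unit `≡ 1 (mod 8)` is a square in `ℤ₂` (tree `padicInt_isSquare_of_toZModPow_three_eq_one`).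
[cite: SilvermanAEC2009, proof of Prop. X.6.2(b) (Exercise 10.12: solutions modulo 8 lift)] -/
private theorem exists_sq_eq_two {c : ℤ} (hc : (c : ZMod (2 ^ 3)) = 1) : ∃ r : ℤ_[2], r ^ 2 = c := by
  have hmod : PadicInt.toZModPow 3 ((c : ℤ) : ℤ_[2]) = 1 := by rw [map_intCast]; exact hc
  obtain ⟨W, hW⟩ := padicInt_isSquare_of_toZModPow_three_eq_one (p := 2) hmod
  exact ⟨W, by rw [sq, ← hW]⟩

/-- Squarefreeness of a (small) integer from the factorisation of its absolute value. [folklore] -/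
private theorem squarefree_int_of_natAbs {d : ℤ} {n : ℕ} (h : d.natAbs = n) (hn : n ≠ 0)
    (hnd : n.primeFactorsList.Nodup) : Squarefree d :=
  Int.squarefree_natAbs.mp (h ▸ (Nat.squarefree_iff_nodup_primeFactorsList hn).mpr hnd)

/-- **`C_{-1} : w² = -1u⁴ + 16u²z² + (-60)z⁴` is everywhere locally soluble**: real point `(3, 1)`
(value `3 > 0`); `ℚ₂`-point `(0, 1)` (value `2²·(-15)`, `-15 ≡ 1 (mod 8)`); `ℚ₃`-point `(1, 1)`
(value `3²·(-5)`, `-5 ≡ 1² (mod 3)`); `ℚ₅`-point `(1, 0)` (value `1²·(-1)`, `-1 ≡ 2² (mod 5)`);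
good reduction at `p ≥ 7`. [cite: SilvermanAEC2009, Prop. X.6.5(a) (the method: local points by Hensel's lemma)]
[cite: BhargavaShankarAnnals2015, Prop. 5.13 (good reduction implies local solubility)] -/
theorem isLocallySoluble_C_m1 : (twoIsogenyQuartic 16 (-1) (-60)).IsLocallySoluble := by
  refine ⟨isSoluble_real_of_pos (u := 3) (z := 1) (v := 3) (Or.inl (by norm_num)) (by norm_num) (by norm_num),
    fun p hp => ?_⟩
  have hP : p.Prime := hp.out
  by_cases h7 : 7 ≤ p
  · exact BinaryQuartic.isSoluble_padic_of_not_dvd_disc (by omega) _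
      (by rw [disc_C (-1) (-60) (by norm_num)]; exact not_dvd_disc h7)
  · interval_cases p
    · exact absurd hP (by decide)
    · exact absurd hP (by decide)
    · obtain ⟨r, hr⟩ := exists_sq_eq_two (c := -15) (by decide)
      exact isSoluble_padic_of_sq (u := 0) (z := 1) (k := 2) (Or.inr (by norm_num)) (by norm_num) hr
    · obtain ⟨r, hr⟩ := exists_sq_eq_intCast (q := 3) (by norm_num) (c := -5) (w := 1) (by norm_num) (by norm_num)
      exact isSoluble_padic_of_sq (u := 1) (z := 1) (k := 3) (Or.inl (by norm_num)) (by norm_num) hr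
    · exact absurd hP (by decide)
    · obtain ⟨r, hr⟩ := exists_sq_eq_intCast (q := 5) (by norm_num) (c := -1) (w := 2) (by norm_num) (by norm_num)
      exact isSoluble_padic_of_sq (u := 1) (z := 0) (k := 1) (Or.inl (by norm_num)) (by norm_num) hr
    · exact absurd hP (by decide)

/-- **`C_{2} : w² = 2u⁴ + 16u²z² + (30)z⁴` is everywhere locally soluble**: real point `(0, 1)`
(value `30 > 0`); `ℚ₂`-point `(1, 3)` (value `4²·(161)`, `161 ≡ 1 (mod 8)`); `ℚ₃`-point `(1, 5)`
(value `3²·(2128)`, `2128 ≡ 1² (mod 3)`); `ℚ₅`-point `(1, 2)` (value `1²·(546)`, `546 ≡ 1² (mod 5)`);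
good reduction at `p ≥ 7`. [cite: SilvermanAEC2009, Prop. X.6.5(a) (the method: local points by Hensel's lemma)]
[cite: BhargavaShankarAnnals2015, Prop. 5.13 (good reduction implies local solubility)] -/
theorem isLocallySoluble_C_2 : (twoIsogenyQuartic 16 (2) (30)).IsLocallySoluble := by
  refine ⟨isSoluble_real_of_pos (u := 0) (z := 1) (v := 30) (Or.inr (by norm_num)) (by norm_num) (by norm_num),
    fun p hp => ?_⟩
  have hP : p.Prime := hp.out
  by_cases h7 : 7 ≤ p
  · exact BinaryQuartic.isSoluble_padic_of_not_dvd_disc (by omega) _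
      (by rw [disc_C (2) (30) (by norm_num)]; exact not_dvd_disc h7)
  · interval_cases p
    · exact absurd hP (by decide)
    · exact absurd hP (by decide)
    · obtain ⟨r, hr⟩ := exists_sq_eq_two (c := 161) (by decide)
      exact isSoluble_padic_of_sq (u := 1) (z := 3) (k := 4) (Or.inl (by norm_num)) (by norm_num) hr
    · obtain ⟨r, hr⟩ := exists_sq_eq_intCast (q := 3) (by norm_num) (c := 2128) (w := 1) (by norm_num) (by norm_num)
      exact isSoluble_padic_of_sq (u := 1) (z := 5) (k := 3) (Or.inl (by norm_num)) (by norm_num) hr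
    · exact absurd hP (by decide)
    · obtain ⟨r, hr⟩ := exists_sq_eq_intCast (q := 5) (by norm_num) (c := 546) (w := 1) (by norm_num) (by norm_num)
      exact isSoluble_padic_of_sq (u := 1) (z := 2) (k := 1) (Or.inl (by norm_num)) (by norm_num) hr
    · exact absurd hP (by decide)

/-- **`C_{3} : w² = 3u⁴ + 16u²z² + (20)z⁴` is everywhere locally soluble**: real point `(0, 1)`
(value `20 > 0`); `ℚ₂`-point `(2, 1)` (value `2²·(33)`, `33 ≡ 1 (mod 8)`); `ℚ₃`-point `(1, 2)`
(value `3²·(43)`, `43 ≡ 1² (mod 3)`); `ℚ₅`-point `(1, 1)` (value `1²·(39)`, `39 ≡ 2² (mod 5)`);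
good reduction at `p ≥ 7`. [cite: SilvermanAEC2009, Prop. X.6.5(a) (the method: local points by Hensel's lemma)]
[cite: BhargavaShankarAnnals2015, Prop. 5.13 (good reduction implies local solubility)] -/
theorem isLocallySoluble_C_3 : (twoIsogenyQuartic 16 (3) (20)).IsLocallySoluble := by
  refine ⟨isSoluble_real_of_pos (u := 0) (z := 1) (v := 20) (Or.inr (by norm_num)) (by norm_num) (by norm_num),
    fun p hp => ?_⟩
  have hP : p.Prime := hp.out
  by_cases h7 : 7 ≤ p
  · exact BinaryQuartic.isSoluble_padic_of_not_dvd_disc (by omega) _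
      (by rw [disc_C (3) (20) (by norm_num)]; exact not_dvd_disc h7)
  · interval_cases p
    · exact absurd hP (by decide)
    · exact absurd hP (by decide)
    · obtain ⟨r, hr⟩ := exists_sq_eq_two (c := 33) (by decide)
      exact isSoluble_padic_of_sq (u := 2) (z := 1) (k := 2) (Or.inl (by norm_num)) (by norm_num) hr
    · obtain ⟨r, hr⟩ := exists_sq_eq_intCast (q := 3) (by norm_num) (c := 43) (w := 1) (by norm_num) (by norm_num)
      exact isSoluble_padic_of_sq (u := 1) (z := 2) (k := 3) (Or.inl (by norm_num)) (by norm_num) hr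
    · exact absurd hP (by decide)
    · obtain ⟨r, hr⟩ := exists_sq_eq_intCast (q := 5) (by norm_num) (c := 39) (w := 2) (by norm_num) (by norm_num)
      exact isSoluble_padic_of_sq (u := 1) (z := 1) (k := 1) (Or.inl (by norm_num)) (by norm_num) hr
    · exact absurd hP (by decide)

/-- **`C_{5} : w² = 5u⁴ + 16u²z² + (12)z⁴` is everywhere locally soluble**: real point `(0, 1)`
(value `12 > 0`); `ℚ₂`-point `(1, 1)` (value `1²·(33)`, `33 ≡ 1 (mod 8)`); `ℚ₃`-point `(4, 1)`
(value `3²·(172)`, `172 ≡ 1² (mod 3)`); `ℚ₅`-point `(1, 2)` (value `1²·(261)`, `261 ≡ 1² (mod 5)`);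
good reduction at `p ≥ 7`. [cite: SilvermanAEC2009, Prop. X.6.5(a) (the method: local points by Hensel's lemma)]
[cite: BhargavaShankarAnnals2015, Prop. 5.13 (good reduction implies local solubility)] -/
theorem isLocallySoluble_C_5 : (twoIsogenyQuartic 16 (5) (12)).IsLocallySoluble := by
  refine ⟨isSoluble_real_of_pos (u := 0) (z := 1) (v := 12) (Or.inr (by norm_num)) (by norm_num) (by norm_num),
    fun p hp => ?_⟩
  have hP : p.Prime := hp.out
  by_cases h7 : 7 ≤ p
  · exact BinaryQuartic.isSoluble_padic_of_not_dvd_disc (by omega) _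
      (by rw [disc_C (5) (12) (by norm_num)]; exact not_dvd_disc h7)
  · interval_cases p
    · exact absurd hP (by decide)
    · exact absurd hP (by decide)
    · obtain ⟨r, hr⟩ := exists_sq_eq_two (c := 33) (by decide)
      exact isSoluble_padic_of_sq (u := 1) (z := 1) (k := 1) (Or.inl (by norm_num)) (by norm_num) hr
    · obtain ⟨r, hr⟩ := exists_sq_eq_intCast (q := 3) (by norm_num) (c := 172) (w := 1) (by norm_num) (by norm_num)
      exact isSoluble_padic_of_sq (u := 4) (z := 1) (k := 3) (Or.inl (by norm_num)) (by norm_num) hr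
    · exact absurd hP (by decide)
    · obtain ⟨r, hr⟩ := exists_sq_eq_intCast (q := 5) (by norm_num) (c := 261) (w := 1) (by norm_num) (by norm_num)
      exact isSoluble_padic_of_sq (u := 1) (z := 2) (k := 1) (Or.inl (by norm_num)) (by norm_num) hr
    · exact absurd hP (by decide)

/-- **`C_{6} : w² = 6u⁴ + 16u²z² + (10)z⁴` is everywhere locally soluble**: real point `(0, 1)`
(value `10 > 0`); `ℚ₂`-point `(5, 1)` (value `8²·(65)`, `65 ≡ 1 (mod 8)`); `ℚ₃`-point `(0, 1)`
(value `1²·(10)`, `10 ≡ 1² (mod 3)`); `ℚ₅`-point `(1, 0)` (value `1²·(6)`, `6 ≡ 1² (mod 5)`);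
good reduction at `p ≥ 7`. [cite: SilvermanAEC2009, Prop. X.6.5(a) (the method: local points by Hensel's lemma)]
[cite: BhargavaShankarAnnals2015, Prop. 5.13 (good reduction implies local solubility)] -/
theorem isLocallySoluble_C_6 : (twoIsogenyQuartic 16 (6) (10)).IsLocallySoluble := by
  refine ⟨isSoluble_real_of_pos (u := 0) (z := 1) (v := 10) (Or.inr (by norm_num)) (by norm_num) (by norm_num),
    fun p hp => ?_⟩
  have hP : p.Prime := hp.out
  by_cases h7 : 7 ≤ p
  · exact BinaryQuartic.isSoluble_padic_of_not_dvd_disc (by omega) _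
      (by rw [disc_C (6) (10) (by norm_num)]; exact not_dvd_disc h7)
  · interval_cases p
    · exact absurd hP (by decide)
    · exact absurd hP (by decide)
    · obtain ⟨r, hr⟩ := exists_sq_eq_two (c := 65) (by decide)
      exact isSoluble_padic_of_sq (u := 5) (z := 1) (k := 8) (Or.inl (by norm_num)) (by norm_num) hr
    · obtain ⟨r, hr⟩ := exists_sq_eq_intCast (q := 3) (by norm_num) (c := 10) (w := 1) (by norm_num) (by norm_num)
      exact isSoluble_padic_of_sq (u := 0) (z := 1) (k := 1) (Or.inr (by norm_num)) (by norm_num) hr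
    · exact absurd hP (by decide)
    · obtain ⟨r, hr⟩ := exists_sq_eq_intCast (q := 5) (by norm_num) (c := 6) (w := 1) (by norm_num) (by norm_num)
      exact isSoluble_padic_of_sq (u := 1) (z := 0) (k := 1) (Or.inl (by norm_num)) (by norm_num) hr
    · exact absurd hP (by decide)

/-- `-1 ∈ S(16, 60)`. [cite: SilvermanAEC2009, Prop. X.4.9] -/
theorem mem_S_m1 : (-1 : ℤ) ∈ twoIsogenySelmerGroup 16 60 :=
  (mem_twoIsogenySelmerGroup_iff (by norm_num)).mpr
    ⟨squarefree_int_of_natAbs (n := 1) rfl (by norm_num) (by simp), by norm_num,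
      by rw [show (60 : ℤ) / -1 = -60 by norm_num]; exact isLocallySoluble_C_m1⟩

/-- `2 ∈ S(16, 60)`. [cite: SilvermanAEC2009, Prop. X.4.9] -/
theorem mem_S_2 : (2 : ℤ) ∈ twoIsogenySelmerGroup 16 60 :=
  (mem_twoIsogenySelmerGroup_iff (by norm_num)).mpr
    ⟨squarefree_int_of_natAbs (n := 2) rfl (by norm_num) (by simp), by norm_num,
      by rw [show (60 : ℤ) / 2 = 30 by norm_num]; exact isLocallySoluble_C_2⟩

/-- `3 ∈ S(16, 60)`. [cite: SilvermanAEC2009, Prop. X.4.9] -/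
theorem mem_S_3 : (3 : ℤ) ∈ twoIsogenySelmerGroup 16 60 :=
  (mem_twoIsogenySelmerGroup_iff (by norm_num)).mpr
    ⟨squarefree_int_of_natAbs (n := 3) rfl (by norm_num) (by simp), by norm_num,
      by rw [show (60 : ℤ) / 3 = 20 by norm_num]; exact isLocallySoluble_C_3⟩

/-- `5 ∈ S(16, 60)`. [cite: SilvermanAEC2009, Prop. X.4.9] -/
theorem mem_S_5 : (5 : ℤ) ∈ twoIsogenySelmerGroup 16 60 :=
  (mem_twoIsogenySelmerGroup_iff (by norm_num)).mpr
    ⟨squarefree_int_of_natAbs (n := 5) rfl (by norm_num) (by simp), by norm_num,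
      by rw [show (60 : ℤ) / 5 = 12 by norm_num]; exact isLocallySoluble_C_5⟩

/-- `6 ∈ S(16, 60)`. [cite: SilvermanAEC2009, Prop. X.4.9] -/
theorem mem_S_6 : (6 : ℤ) ∈ twoIsogenySelmerGroup 16 60 :=
  (mem_twoIsogenySelmerGroup_iff (by norm_num)).mpr
    ⟨squarefree_int_of_natAbs (n := 6) rfl (by norm_num) (by simp), by norm_num,
      by rw [show (60 : ℤ) / 6 = 10 by norm_num]; exact isLocallySoluble_C_6⟩


/-- `1 ∈ S(16, 60)` (the class of `O`). [cite: SilvermanAEC2009, Prop. X.4.9] -/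
theorem mem_S_1 : (1 : ℤ) ∈ twoIsogenySelmerGroup 16 60 := one_mem_twoIsogenySelmerGroup 16 (by norm_num)

/-- `15 ∈ S(16, 60)` (the class `[60] = [15]` of `T' = (0,0) ∈ X'(ℚ)`). [cite: SilvermanAEC2009, Prop. X.4.9] -/
theorem mem_S_15 : (15 : ℤ) ∈ twoIsogenySelmerGroup 16 60 :=
  mem_twoIsogenySelmerGroup_of_isSquare (by norm_num)
    (squarefree_int_of_natAbs (n := 15) rfl (by norm_num) (by simp)) (by norm_num) ⟨2, by norm_num⟩

/-- `−6 ∈ S(16, 60)` (the class of `(−6, 0) ∈ X'(ℚ)`: the rational point `(1, 1, 0)` of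
`w² = −6u⁴ + 16u²z² − 10z⁴`). [cite: SilvermanAEC2009, Prop. X.4.9] -/
theorem mem_S_m6 : (-6 : ℤ) ∈ twoIsogenySelmerGroup 16 60 :=
  (mem_twoIsogenySelmerGroup_iff (by norm_num)).mpr
    ⟨squarefree_int_of_natAbs (n := 6) rfl (by norm_num) (by simp), by norm_num, by
      rw [show (60 : ℤ) / -6 = -10 by norm_num]
      exact ⟨isSoluble_of_int_point (u := 1) (z := 1) (w := 0) (Or.inl one_ne_zero) (by norm_num),
        fun p _ => isSoluble_of_int_point (u := 1) (z := 1) (w := 0) (Or.inl one_ne_zero) (by norm_num)⟩⟩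

/-- `−10 ∈ S(16, 60)` (the class of `(−10, 0) ∈ X'(ℚ)`: the rational point `(1, 1, 0)` of
`w² = −10u⁴ + 16u²z² − 6z⁴`). [cite: SilvermanAEC2009, Prop. X.4.9] -/
theorem mem_S_m10 : (-10 : ℤ) ∈ twoIsogenySelmerGroup 16 60 :=
  (mem_twoIsogenySelmerGroup_iff (by norm_num)).mpr
    ⟨squarefree_int_of_natAbs (n := 10) rfl (by norm_num) (by simp), by norm_num, by
      rw [show (60 : ℤ) / -10 = -6 by norm_num]
      exact ⟨isSoluble_of_int_point (u := 1) (z := 1) (w := 0) (Or.inl one_ne_zero) (by norm_num),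
        fun p _ => isSoluble_of_int_point (u := 1) (z := 1) (w := 0) (Or.inl one_ne_zero) (by norm_num)⟩⟩

/-- **`#S(16, 60) ≥ 9`**, from the nine classes `1, 15, −6, −10, −1, 2, 3, 5, 6`. [cite: SilvermanAEC2009, Prop. X.4.9] -/
theorem nine_le_card_twoIsogenySelmerGroup : 9 ≤ (twoIsogenySelmerGroup 16 60).card := by
  calc 9 = ({1, 15, -6, -10, -1, 2, 3, 5, 6} : Finset ℤ).card := by decide
    _ ≤ (twoIsogenySelmerGroup 16 60).card := by
      refine Finset.card_le_card ?_
      intro d hd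
      simp only [Finset.mem_insert, Finset.mem_singleton] at hd
      rcases hd with rfl | rfl | rfl | rfl | rfl | rfl | rfl | rfl | rfl
      · exact mem_S_1
      · exact mem_S_15
      · exact mem_S_m6
      · exact mem_S_m10
      · exact mem_S_m1
      · exact mem_S_2
      · exact mem_S_3
      · exact mem_S_5
      · exact mem_S_6

/-- `b(a² − 4b) ≠ 0` for `(a, b) = (16, 60)`. [cite: SilvermanAEC2009, Prop. X.4.9] -/
private theorem hab' : (60 : ℤ) * ((16 : ℤ) ^ 2 - 4 * 60) ≠ 0 := by norm_num

/-- **`dim₂ S(16, 60) = 4`**: the order `2^{dim}` of the Selmer group is at least `9` and at most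
`2^{ω(60)+1} = 16`, so all sixteen classes `±d`, `d ∣ 30`, are everywhere locally soluble.
[cite: SilvermanAEC2009, Prop. X.4.9] -/
theorem twoIsogenySelmerRank_16_60 : twoIsogenySelmerRank 16 60 = 4 := by
  have hle : twoIsogenySelmerRank 16 60 ≤ 4 := by
    have h := twoIsogenySelmerRank_le 16 (b := 60) (by norm_num)
    have h3 : (60 : ℤ).natAbs.primeFactors.card = 3 := by decide +kernel
    omega
  have hge : 9 ≤ 2 ^ twoIsogenySelmerRank 16 60 := by
    rw [two_pow_twoIsogenySelmerRank_eq_card hab']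
    exact nine_le_card_twoIsogenySelmerGroup
  interval_cases (twoIsogenySelmerRank 16 60) <;> simp_all

/-- `dim₂ S'(−8, 1) = dim₂ S(16, 60) = 4`. [cite: SilvermanAEC2009, Prop. X.4.9] -/
theorem twoIsogenySelmerRank'_X : twoIsogenySelmerRank' (-8) 1 = 4 := by
  rw [twoIsogenySelmerRank', show (-2 * -8 : ℤ) = 16 by norm_num, show ((-8 : ℤ) ^ 2 - 4 * 1 : ℤ) = 60 by norm_num]
  exact twoIsogenySelmerRank_16_60

end XCubeSub8XSqAddX

end Literature.NumberTheory.EllipticCurves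

end
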